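import Literature.AlgebraicGeometry.HodgeTheory.HodgeLociClosedOfQuasiProjective
import Literature.AlgebraicGeometry.HodgeTheory.UniversalHypersurfaceHodgeLoci
import Literature.AlgebraicGeometry.Motives.UniversalHypersurfaceQuasiProjective
import HarnessLib

/-!
# Lemma 5.13 for the universal family of hypersurfaces, UNCONDITIONAL — the hypothesis `hcl` of the
# Noether–Lefschetz reduction `UniversalHypersurfaceHodgeLoci` discharged with ZERO named facts

Family `hodge`, layer `Literature/AlgebraicGeometry/HodgeTheory`; proof file (theorems only, no definition, no named
fact). Written by the prover seat `hodge-nonav-20241-p1` (g20, cell `hodge-nonav`). Twin of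
`UniversalHypersurfaceHodgeLociOfGriffiths` (this seat, g12) with the named fact `Griffiths1968_holomorphicHodgeSubbundles`
REPLACED by the tree theorem `isInHodgeFiltration_fiberRestrict_of_mem_closure_of_isQuasiProjectiveOver`
(`HodgeLociClosedOfQuasiProjective`, from the cell's `griffiths1968_holomorphicHodgeSubbundlesQP_holds`): the total space
`𝒴_U` of the universal family of smooth degree-`d` hypersurfaces in `ℙⁿ⁺¹_ℂ` is quasi-projective
(`isQuasiProjectiveOver_total`), so Voisin II Lemma 5.13 for it holds with NO hypothesis:

* `UniversalHypersurface.isInHodgeFiltration_of_mem_closure` — `hcl` for `family ℂ n d`, unconditional;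
* `UniversalHypersurface.exists_forall_isIntegralClass_imp_eq_zero_of_climb`,
  `UniversalHypersurface.exists_isSmoothHypersurface_forall_isIntegralClass_imp_eq_zero_of_climb` — the one-model
  Noether–Lefschetz conclusions from `hclimb` (Voisin II Cor. 5.17 + Thm. 6.13) ALONE.

Consumer: the barrier reduction `Voisin2003_generalHypersurface_noIntegralClassInF_of_climb_of_closed`
(`Barriers/HodgeConjecture/NormalFunctionsOfGriffiths`) now needs `hclimb` only. Honest scope: nothing here says HC,
HC_CM or HC_AV is proved.

## References

* [VoisinHodgeII2003] C. Voisin, Hodge Theory and Complex Algebraic Geometry II, CUP (2003), §5.3.1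
  Lemma 5.13, §5.3.2 Cor. 5.17, Thm. 6.24 (proof), Lemma 8.18 (proof).
* [VoisinHodgeI2002] C. Voisin, Hodge Theory and Complex Algebraic Geometry I, CUP (2002), §10.2.1 Thm. 10.3.
* [Griffiths1968PeriodsII] P. Griffiths, Periods of integrals on algebraic manifolds II, Amer. J. Math. 90 (1968), Thm. 1.1.
-/

noncomputable section

open CategoryTheory AlgebraicGeometry
open _root_.Topology _root_.Filter
open Literature.AlgebraicTopology.SingularHomology

namespace Literature.AlgebraicGeometry.HodgeTheory

namespace UniversalHypersurface

open Motives.UniversalHypersurface Literature.AlgebraicGeometry.Motives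

variable (n d : ℕ)

/-- **Voisin II Lemma 5.13 for the universal family of smooth hypersurfaces, UNCONDITIONAL**: the locus
`{u ∈ B | ξ|_{Y_u} ∈ FʳHⁿ(Y_u)}` of a tube class `ξ ∈ Hⁿ(π⁻¹B(ℂ); ℂ)` is closed in the open `B ⊆ U(ℂ)` — VERBATIM
the hypothesis `hcl` of `exists_forall_isIntegralClass_imp_eq_zero_of_climb_of_closed`; the total space is quasi-projective
(`isQuasiProjectiveOver_total`) and Griffiths' theorem is the tree's `griffiths1968_holomorphicHodgeSubbundlesQP_holds`.
[cite: VoisinHodgeII2003, §5.3.1 Lemma 5.13] [cite: VoisinHodgeI2002, §10.2.1 Thm. 10.3] [cite: Griffiths1968PeriodsII, Thm. 1.1] -/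
theorem isInHodgeFiltration_of_mem_closure (hn : 1 ≤ n) (hd : 1 ≤ d) (r : ℕ) :
    ∀ (B : Set (universalHypersurfaceBasePoints n d)), IsOpen B →
      ∀ (ξ : singularCohomology ℂ ℂ (tubeOver (family ℂ n d) B) n)
        (u : universalHypersurfaceBasePoints n d) (hu : u ∈ B),
        u ∈ closure {u' | ∃ hu' : u' ∈ B,
          IsInHodgeFiltration n (Motives.fiberOver (family ℂ n d) u') n r
            (fiberRestrict (family ℂ n d) hu' n ξ)} →
        IsInHodgeFiltration n (Motives.fiberOver (family ℂ n d) u) n r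
          (fiberRestrict (family ℂ n d) hu n ξ) := by
  intro B hBo ξ u hu hcl
  haveI := smoothOfRelativeDimension_base_hom ℂ n d
  exact isInHodgeFiltration_fiberRestrict_of_mem_closure_of_isQuasiProjectiveOver (family ℂ n d) n n
    (0 + Fintype.card (DegIndex n d)) (isSmoothProjectiveFamily_family ℂ hn hd)
    (isQuasiProjectiveOver_base ℂ n d) (isQuasiProjectiveOver_total ℂ n d) hBo ξ r hu hcl

/-- **The one-model Noether–Lefschetz statement from Cor. 5.17 ∕ Thm. 6.13 (`hclimb`) ALONE** (no named fact):
some fibre `Y_s` of the universal family, with a Hodge model `A`, has no non-zero integral class of `Hⁿ(Y_s(ℂ); ℂ)`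
pulling back into `FʳHⁿ(A)` — `exists_forall_isIntegralClass_imp_eq_zero_of_climb_of_closed` with `hcl` discharged
unconditionally. [cite: VoisinHodgeII2003, Lemma 8.18 (proof), Thm. 6.24 (proof), Cor. 5.17 and Lemma 5.13]
[cite: VoisinHodgeI2002, §10.2.1 Thm. 10.3] [cite: Griffiths1968PeriodsII, Thm. 1.1] -/
theorem exists_forall_isIntegralClass_imp_eq_zero_of_climb
    (hn : 1 ≤ n) (hd : 1 ≤ d) {r : ℕ} (hr : r ≤ n + 1)
    (hclimb : ∀ (B : Set (universalHypersurfaceBasePoints n d)), IsOpen B →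
      ∀ (ξ : singularCohomology ℂ ℂ (tubeOver (family ℂ n d) B) n) (p : ℕ), r ≤ p → p ≤ n →
      ∀ (u : universalHypersurfaceBasePoints n d) (hu : u ∈ B),
        (∀ᶠ u' in 𝓝 u, ∃ hu' : u' ∈ B,
          IsInHodgeFiltration n (Motives.fiberOver (family ℂ n d) u') n p
            (fiberRestrict (family ℂ n d) hu' n ξ)) →
        IsInHodgeFiltration n (Motives.fiberOver (family ℂ n d) u) n (p + 1)
          (fiberRestrict (family ℂ n d) hu n ξ)) :
    ∃ (s : universalHypersurfaceBasePoints n d) (A : HodgeModel n (Motives.fiberOver (family ℂ n d) s)),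
      ∀ c : complexBetti (Motives.fiberOver (family ℂ n d) s) n,
        IsIntegralClass c → A.pullback n c ∈ A.hodgeFiltration n r → c = 0 :=
  exists_forall_isIntegralClass_imp_eq_zero_of_climb_of_closed n d hn hd hr hclimb
    (isInHodgeFiltration_of_mem_closure n d hn hd r)

/-- **A smooth hypersurface of degree `d` in `ℙⁿ⁺¹` with no non-zero integral class in `FʳHⁿ`, from `hclimb`
ALONE** (no named fact; `exists_isSmoothHypersurface_…_of_climb_of_closed` with `hcl` discharged unconditionally).
[cite: VoisinHodgeII2003, Lemma 8.18 (proof) and Thm. 6.24] [cite: VoisinHodgeI2002, §10.2.1 Thm. 10.3]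
[cite: Griffiths1968PeriodsII, Thm. 1.1] -/
theorem exists_isSmoothHypersurface_forall_isIntegralClass_imp_eq_zero_of_climb
    (hn : 1 ≤ n) (hd : 1 ≤ d) {r : ℕ} (hr : r ≤ n + 1)
    (hclimb : ∀ (B : Set (universalHypersurfaceBasePoints n d)), IsOpen B →
      ∀ (ξ : singularCohomology ℂ ℂ (tubeOver (family ℂ n d) B) n) (p : ℕ), r ≤ p → p ≤ n →
      ∀ (u : universalHypersurfaceBasePoints n d) (hu : u ∈ B),
        (∀ᶠ u' in 𝓝 u, ∃ hu' : u' ∈ B,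
          IsInHodgeFiltration n (Motives.fiberOver (family ℂ n d) u') n p
            (fiberRestrict (family ℂ n d) hu' n ξ)) →
        IsInHodgeFiltration n (Motives.fiberOver (family ℂ n d) u) n (p + 1)
          (fiberRestrict (family ℂ n d) hu n ξ)) :
    ∃ X : Motives.SchemeOver ℂ, Motives.IsSmoothHypersurface n d X ∧ ∃ A : HodgeModel n X,
      ∀ c : complexBetti X n, IsIntegralClass c → A.pullback n c ∈ A.hodgeFiltration n r → c = 0 :=
  exists_isSmoothHypersurface_forall_isIntegralClass_imp_eq_zero_of_climb_of_closed n d hn hd hr hclimb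
    (isInHodgeFiltration_of_mem_closure n d hn hd r)

end UniversalHypersurface

end Literature.AlgebraicGeometry.HodgeTheory

end
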